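import Mathlib
import HarnessLib.Audit
import Summits.PneNP.PneNP.Theorems.PstarNorUnitNACases

/-!
# `nor_unit` for the bridge: gadgets demanded only for NON-ADJACENT literal pairs (ROUND-24, memo §9 R7/R8; O5 impossible)

FRONTIER range-avoidance ladder, rung F-N3, ROUND 24 (cell `pnp-ideate`, planner memo `r24/CORE-BOUND-NOTES.md` §9 R7 (NOR case) / R8, §10 O5,
§13; restricted-model proof complexity — nothing here bears on `P` versus `NP`).

`PstarNorUnit.nor_unit` assumed that EVERY literal product `{v,w}` (`ℓ₁(e_v)ℓ₂(e_w) + ℓ₁(e_w)ℓ₂(e_v) = 1`) is realised by an output of a set `G`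
disjoint from the cycle family `P ∪ {e}`.  In the bridge (`PstarChordBridgeForcing.forced_chord_cases_sys`) the realisers are the join `T₂` and
the private-free pendants of the second constraint, and a join output may itself lie in the fundamental set `D e = P`.  This file proves the
same conclusion from the WEAKER hypothesis that only pairs `{v, w}` NOT AND-adjacent in `P` are realised in `G` (for those the realiser is
automatically outside `P ∪ {e}`, by simple overlaps):

* `false_of_cherry_na` — the cherry-plus-edge dies: a non-adjacent literal pair with `det = 1` gives one gadget (`14 < 15`); otherwise all
  non-adjacent minors vanish, and then so do the adjacent ones (`zero_of_dets`: an edge `{x,y}` with `det(π_x,π_y) = 1` forces the profiles of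
  the OTHER, vertex-disjoint edge to vanish, contradicting `lit_of_adj`), so `rank_lt_of_dets_zero` applies;
* `nor_unit_na` — **the NOR case of `forced_chord_cases` is a CONS-T unit with single literals**: `P = {j₁, j₂}` with disjoint AND pairs, the
  literal variables are exactly `{σ, τ}` (`σ ∈ andPair j₁`, `τ ∈ andPair j₂`), and a gadget `(σ, τ) ∈ G` exists.
-/

set_option linter.dupNamespace false -- `Summit.PneNP.PneNP.…`: summit = sub-problem name (D-0017 single-conjunct layout)

open Finset Module Literature.Computability.Complexity
open Summit.PneNP.PneNP.Theorems.PstarSALevel (varSet bdry BoundaryExpanding SimpleOverlap)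
open Summit.PneNP.PneNP.Theorems.PstarGapLinearised (andPair andPair_subset_varSet)
open Summit.PneNP.PneNP.Theorems.PstarChordEndgameTools (mem_andPair_iff)
open Summit.PneNP.PneNP.Theorems.PstarCubeIdeals (IsAffineFn)
open Summit.PneNP.PneNP.Theorems.PstarQuadRank (rad)
open Summit.PneNP.PneNP.Theorems.PstarRankRigidityTwo (linPart)
open Summit.PneNP.PneNP.Theorems.PstarProductRank (qform polar IsInducedMatching)
open Summit.PneNP.PneNP.Theorems.PstarPathRank (AndAdj and_ne)
open Summit.PneNP.PneNP.Theorems.PstarNorUnitPolar (exists_mem_andPair_of_lit adj_eq card_le_two_of_isInducedMatching two_le_card)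
open Summit.PneNP.PneNP.Theorems.PstarNorUnitGraph (adeg leafEdges mem_leafEdges adeg_pos card_leaves_le two_edges_or_cherry)
open Summit.PneNP.PneNP.Theorems.PstarNorUnitTools (lit_of_adj rank_lt_of_dets_zero)
open Summit.PneNP.PneNP.Theorems.PstarNorUnitCases (lits_of_det andPair_eq_of_mem andAdj_of_mem mem_of_andAdj false_of_gadgets)
open Summit.PneNP.PneNP.Theorems.PstarNorUnitNACases (of_lits_na false_of_four_lit_na)

namespace Summit.PneNP.PneNP.Theorems.PstarNorUnitNA

variable {n m : ℕ}

/-- In `𝔽₂`, `x + x = 0`. -/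
private theorem zmod2_add_self (x : ZMod 2) : x + x = 0 := by
  revert x; decide

/-- **A `det = 1` pair annihilates every profile with vanishing minors against both**: `det(s,v) = 1`, `det(s,z) = det(v,z) = 0` force
`π_z = 0`. -/
theorem zero_of_dets {s₁ s₂ v₁ v₂ z₁ z₂ : ZMod 2} (h : s₁ * v₂ + v₁ * s₂ = 1) (hs : s₁ * z₂ + z₁ * s₂ = 0) (hv : v₁ * z₂ + z₁ * v₂ = 0) :
    z₁ = 0 ∧ z₂ = 0 := by
  revert h hs hv s₁ s₂ v₁ v₂ z₁ z₂; decide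

/-- Two distinct outputs of `P` holding `v` in an AND slot give `adeg P v ≥ 2`. -/
theorem two_le_adeg {I : LocalMap 4 n m} {P : Finset (Fin m)} {j j' : Fin m} (hj : j ∈ P) (hj' : j' ∈ P) (hne : j ≠ j') {v : Fin n}
    (hv : v ∈ andPair I j) (hv' : v ∈ andPair I j') : 2 ≤ adeg I P v := by
  unfold adeg
  have h : ({j, j'} : Finset (Fin m)) ⊆ P.filter fun i => v ∈ andPair I i := by
    intro i hi
    rw [mem_insert, mem_singleton] at hi
    rcases hi with rfl | rfl
    · exact mem_filter.2 ⟨hj, hv⟩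
    · exact mem_filter.2 ⟨hj', hv'⟩
  exact (card_pair hne).symm.le.trans (card_le_card h)

section Main

variable {I : LocalMap 4 n m} (hI : I.IsPure xorAndPred) (hS : SimpleOverlap I) {r : ℕ} (hB : BoundaryExpanding r I)
  {P G : Finset (Fin m)} {e : Fin m} (he : e ∉ P) (hGd : Disjoint G (insert e P)) (hr : (insert e P ∪ G).card ≤ r)
  (hcyc : ∀ j ∈ insert e P, ∀ s : Fin 4, s.val < 2 → I.vars j s ∉ bdry I (insert e P))
  {μ₁ μ₂ m₁ m₂ : (Fin n → ZMod 2) → ZMod 2} (hμ₁ : IsAffineFn μ₁) (hμ₂ : IsAffineFn μ₂) (hm₁ : IsAffineFn m₁) (hm₂ : IsAffineFn m₂)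
  {c : ZMod 2} (hQ : ∀ x, qform P (fun j => I.vars j 2) (fun j => I.vars j 3) x + c = μ₁ x * m₁ x + μ₂ x * m₂ x)

include hI hS hB he hGd hr hcyc hμ₁ hμ₂ hm₁ hm₂ hQ

/-- **The cherry-plus-edge is impossible** (non-adjacent gadgets suffice; see the module docstring). -/
theorem false_of_cherry_na
    (hK : ∀ v w : Fin n, v ≠ w → ¬ AndAdj I P v w →
      linPart hμ₁ (Pi.single v 1) * linPart hμ₂ (Pi.single w 1) + linPart hμ₁ (Pi.single w 1) * linPart hμ₂ (Pi.single v 1) = 1 →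
        ∃ g ∈ G, v ∈ andPair I g ∧ w ∈ andPair I g)
    (hrank : finrank (ZMod 2) (rad (polar P (fun j => I.vars j 2) (fun j => I.vars j 3))) + 4 ≤ finrank (ZMod 2) (Fin n → ZMod 2))
    {j₀ j₂ j₃ : Fin m} {cc : Fin n} (h02 : j₀ ≠ j₂) (h03 : j₀ ≠ j₃) (h23 : j₂ ≠ j₃) (hP : P = {j₀, j₂, j₃}) (hc0 : cc ∈ andPair I j₀)
    (hc2 : cc ∈ andPair I j₂) (hc3 : cc ∉ andPair I j₃) (hadeg : adeg I P cc = 2) (hother : ∀ v : Fin n, v ≠ cc → adeg I P v ≤ 1) :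
    False := by
  classical
  have hadj := adj_eq hμ₁ hμ₂ hm₁ hm₂ hQ hI hS
  have zc : ∀ t : ZMod 2, t = 0 ∨ t = 1 := by decide
  have hj₀ : j₀ ∈ P := by rw [hP]; simp
  have hj₂ : j₂ ∈ P := by rw [hP]; simp
  have hj₃ : j₃ ∈ P := by rw [hP]; simp
  have hP3 : P.card = 3 := by
    rw [hP, card_insert_of_notMem (by simp [h02, h03]), card_pair h23]
  -- the AND pair of `j₃` is disjoint from those of `j₀` and `j₂`
  have hD : ∀ {j : Fin m}, j ∈ P → j ≠ j₃ → cc ∈ andPair I j → ∀ v, v ∈ andPair I j → v ∈ andPair I j₃ → False := by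
    intro j hj hne hcj v hv hv3
    have hvc : v ≠ cc := fun h => hc3 (h ▸ hv3)
    have := two_le_adeg hj hj₃ hne hv hv3
    have := hother v hvc
    omega
  by_cases hdet : ∃ x ∈ P.biUnion (andPair I), ∃ y ∈ P.biUnion (andPair I), x ≠ y ∧ ¬ AndAdj I P x y ∧
      linPart hμ₁ (Pi.single x 1) * linPart hμ₂ (Pi.single y 1) + linPart hμ₁ (Pi.single y 1) * linPart hμ₂ (Pi.single x 1) = 1
  · -- one gadget kills
    obtain ⟨x, hx, y, hy, hxy, hna, hd⟩ := hdet
    obtain ⟨g, hg, hxg, hyg⟩ := hK x y hxy hna hd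
    have hAg := andPair_eq_of_mem hxg hyg hxy
    obtain ⟨z, hzg, hzc⟩ : ∃ z ∈ andPair I g, z ≠ cc := by
      by_cases hxc : x = cc
      · exact ⟨y, hyg, fun h => hxy (hxc.trans h.symm)⟩
      · exact ⟨x, hxg, hxc⟩
    have hzA : z ∈ P.biUnion (andPair I) := by
      rw [hAg, mem_insert, mem_singleton] at hzg
      rcases hzg with rfl | rfl
      · exact hx
      · exact hy
    have hz1 : adeg I P z = 1 := by
      obtain ⟨j, hj, hzj⟩ := mem_biUnion.1 hzA
      exact le_antisymm (hother z hzc) (adeg_pos hj hzj)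
    have hEL : (leafEdges I P).card ≤ 1 := by
      refine (card_le_card fun j hj => ?_).trans (card_singleton j₃).le
      obtain ⟨hjP, hj2, hj3⟩ := mem_leafEdges.1 hj
      have key : cc ∉ andPair I j := by
        intro hcj
        rcases (mem_andPair_iff I j cc).1 hcj with h | h
        · rw [← h] at hj2; omega
        · rw [← h] at hj3; omega
      rw [hP] at hjP
      simp only [mem_insert, mem_singleton] at hjP
      rcases hjP with rfl | rfl | rfl
      · exact absurd hc0 key
      · exact absurd hc2 key
      · exact mem_singleton_self _
    have hL : (univ.filter fun v => adeg I P v = 1).card ≤ 4 := by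
      have := card_leaves_le (I := I) (P := P); omega
    refine false_of_gadgets hB hGd hr hcyc {g} (fun g' hg' => by rw [mem_singleton] at hg'; rw [hg']; exact hg) ?_ 3 ?_ ?_
    · intro g' hg' v hv
      rw [mem_singleton] at hg'
      rw [hg', hAg, mem_insert, mem_singleton] at hv
      rcases hv with rfl | rfl
      · exact mem_biUnion.1 hx
      · exact mem_biUnion.1 hy
    · calc ((univ.filter fun v => adeg I P v = 1).filter fun v => ∀ g' ∈ ({g} : Finset (Fin m)), v ∉ andPair I g').card
          ≤ ((univ.filter fun v => adeg I P v = 1).erase z).card := by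
            refine card_le_card fun v hv => ?_
            rw [mem_filter] at hv
            rw [mem_erase]
            exact ⟨fun h => hv.2 g (mem_singleton_self _) (h ▸ hzg), hv.1⟩
        _ = (univ.filter fun v => adeg I P v = 1).card - 1 := card_erase_of_mem (mem_filter.2 ⟨mem_univ _, hz1⟩)
        _ ≤ 3 := by omega
    · rw [card_insert_of_notMem he, hP3, card_singleton]; norm_num
  · -- no non-adjacent `det = 1` pair: then no `det = 1` pair at all, and the rank bound bites
    have hdet' : ∀ p ∈ P.biUnion (andPair I), ∀ q ∈ P.biUnion (andPair I), p ≠ q → ¬ AndAdj I P p q →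
        linPart hμ₁ (Pi.single p 1) * linPart hμ₂ (Pi.single q 1) + linPart hμ₁ (Pi.single q 1) * linPart hμ₂ (Pi.single p 1) = 1 →
        False := fun p hp q hq hpq hna hd => hdet ⟨p, hp, q, hq, hpq, hna, hd⟩
    -- an adjacent `det = 1` pair kills the literal ends of the other, vertex-disjoint edge
    have hedge : ∀ {j j' : Fin m}, j ∈ P → j' ∈ P → (∀ v, v ∈ andPair I j → v ∈ andPair I j' → False) →
        (∀ a b, a ∈ andPair I j → b ∈ andPair I j' → ¬ AndAdj I P a b) → ∀ {v w : Fin n}, v ∈ andPair I j → w ∈ andPair I j → v ≠ w →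
        linPart hμ₁ (Pi.single v 1) * linPart hμ₂ (Pi.single w 1) + linPart hμ₁ (Pi.single w 1) * linPart hμ₂ (Pi.single v 1) = 1 →
        False := by
      intro j j' hj hj' hdis hna v w hv hw hvw hd
      have ha : I.vars j' 2 ∈ andPair I j' := (mem_andPair_iff I j' _).2 (Or.inl rfl)
      have hb : I.vars j' 3 ∈ andPair I j' := (mem_andPair_iff I j' _).2 (Or.inr rfl)
      have hvA : v ∈ P.biUnion (andPair I) := mem_biUnion.2 ⟨j, hj, hv⟩
      have hwA : w ∈ P.biUnion (andPair I) := mem_biUnion.2 ⟨j, hj, hw⟩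
      have haA : I.vars j' 2 ∈ P.biUnion (andPair I) := mem_biUnion.2 ⟨j', hj', ha⟩
      have hbA : I.vars j' 3 ∈ P.biUnion (andPair I) := mem_biUnion.2 ⟨j', hj', hb⟩
      -- the four cross minors vanish
      have dz : ∀ {p q : Fin n}, p ∈ andPair I j → q ∈ andPair I j' → p ∈ P.biUnion (andPair I) → q ∈ P.biUnion (andPair I) →
          linPart hμ₁ (Pi.single p 1) * linPart hμ₂ (Pi.single q 1) + linPart hμ₁ (Pi.single q 1) * linPart hμ₂ (Pi.single p 1) = 0 := by
        intro p q hp hq hpA hqA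
        have hpq : p ≠ q := fun h => hdis p hp (h ▸ hq)
        rcases zc (linPart hμ₁ (Pi.single p 1) * linPart hμ₂ (Pi.single q 1) + linPart hμ₁ (Pi.single q 1) * linPart hμ₂ (Pi.single p 1))
          with h0 | h1
        · exact h0
        · exact (hdet' p hpA q hqA hpq (hna p q hp hq) h1).elim
      have za := zero_of_dets hd (dz hv ha hvA haA) (dz hw ha hwA haA)
      have zb := zero_of_dets hd (dz hv hb hvA hbA) (dz hw hb hwA hbA)
      have e' := hadj (I.vars j' 2) (I.vars j' 3)
      rw [if_pos ⟨j', hj', Or.inl ⟨rfl, rfl⟩⟩, za.1, za.2, zb.1, zb.2] at e'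
      simp at e'
    -- non-adjacency of cross pairs between `j₃` and `j₀`/`j₂`
    have hna3 : ∀ {j : Fin m}, j ∈ P → j ≠ j₃ → cc ∈ andPair I j →
        ∀ a b, a ∈ andPair I j → b ∈ andPair I j₃ → ¬ AndAdj I P a b ∧ ¬ AndAdj I P b a := by
      intro j hj hne hcj a b ha hb
      have key : ∀ {p q : Fin n}, AndAdj I P p q → (p = a ∧ q = b) ∨ (p = b ∧ q = a) → False := by
        intro p q hA hpq
        obtain ⟨i, hi, hpi, hqi⟩ := mem_of_andAdj hA
        have hai : a ∈ andPair I i := by rcases hpq with ⟨rfl, rfl⟩ | ⟨rfl, rfl⟩; exacts [hpi, hqi]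
        have hbi : b ∈ andPair I i := by rcases hpq with ⟨rfl, rfl⟩ | ⟨rfl, rfl⟩; exacts [hqi, hpi]
        rw [hP] at hi
        simp only [mem_insert, mem_singleton] at hi
        rcases hi with rfl | rfl | rfl
        · exact hD hj₀ h03 hc0 b hbi hb
        · exact hD hj₂ h23 hc2 b hbi hb
        · exact hD hj hne hcj a ha hai
      exact ⟨fun hA => key hA (Or.inl ⟨rfl, rfl⟩), fun hA => key hA (Or.inr ⟨rfl, rfl⟩)⟩
    refine rank_lt_of_dets_zero hμ₁ hμ₂ hm₁ hm₂ hQ (fun v w => ?_) hrank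
    rcases zc (linPart hμ₁ (Pi.single v 1) * linPart hμ₂ (Pi.single w 1) +
        linPart hμ₁ (Pi.single w 1) * linPart hμ₂ (Pi.single v 1)) with h0 | h1
    · exact h0
    · exfalso
      obtain ⟨hlv, hlw⟩ := lits_of_det h1
      obtain ⟨jv, hjv, hvj⟩ := exists_mem_andPair_of_lit hμ₁ hμ₂ hm₁ hm₂ hQ hrank hlv
      obtain ⟨jw, hjw, hwj⟩ := exists_mem_andPair_of_lit hμ₁ hμ₂ hm₁ hm₂ hQ hrank hlw
      have hvw : v ≠ w := by
        rintro rfl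
        rw [zmod2_add_self] at h1
        exact zero_ne_one h1
      by_cases hA : AndAdj I P v w
      · -- an adjacent `det = 1` pair
        obtain ⟨j, hj, hvj', hwj'⟩ := mem_of_andAdj hA
        have hjP := hj
        rw [hP] at hjP
        simp only [mem_insert, mem_singleton] at hjP
        rcases hjP with rfl | rfl | rfl
        · exact hedge hj hj₃ (hD hj h03 hc0) (fun a b ha hb => (hna3 hj h03 hc0 a b ha hb).1) hvj' hwj' hvw h1
        · exact hedge hj hj₃ (hD hj h23 hc2) (fun a b ha hb => (hna3 hj h23 hc2 a b ha hb).1) hvj' hwj' hvw h1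
        · exact hedge hj hj₀ (fun a ha h0 => hD hj₀ h03 hc0 a h0 ha) (fun a b ha hb => (hna3 hj₀ h03 hc0 b a hb ha).2)
            hvj' hwj' hvw h1
      · exact hdet' v (mem_biUnion.2 ⟨jv, hjv, hvj⟩) w (mem_biUnion.2 ⟨jw, hjw, hwj⟩) hvw hA h1

/-- **`nor_unit_na` — a NOR-forced chord is a CONS-T unit with single literals**, with gadgets demanded only for non-adjacent pairs. -/
theorem nor_unit_na
    (hK : ∀ v w : Fin n, v ≠ w → ¬ AndAdj I P v w →
      linPart hμ₁ (Pi.single v 1) * linPart hμ₂ (Pi.single w 1) + linPart hμ₁ (Pi.single w 1) * linPart hμ₂ (Pi.single v 1) = 1 →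
        ∃ g ∈ G, v ∈ andPair I g ∧ w ∈ andPair I g)
    (hrank : finrank (ZMod 2) (rad (polar P (fun j => I.vars j 2) (fun j => I.vars j 3))) + 4 ≤ finrank (ZMod 2) (Fin n → ZMod 2)) :
    ∃ j₁ j₂ : Fin m, ∃ σ τ : Fin n, j₁ ≠ j₂ ∧ P = {j₁, j₂} ∧ Disjoint (andPair I j₁) (andPair I j₂) ∧ σ ∈ andPair I j₁ ∧ τ ∈ andPair I j₂ ∧
      (∀ v : Fin n, (linPart hμ₁ (Pi.single v 1) ≠ 0 ∨ linPart hμ₂ (Pi.single v 1) ≠ 0) ↔ (v = σ ∨ v = τ)) ∧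
      ∃ g ∈ G, σ ∈ andPair I g ∧ τ ∈ andPair I g := by
  classical
  have hadj := adj_eq hμ₁ hμ₂ hm₁ hm₂ hQ hI hS
  have h2 : 2 ≤ P.card := two_le_card hrank
  have hIM : ∀ M : Finset (Fin m), IsInducedMatching P M (fun j => I.vars j 2) (fun j => I.vars j 3) → M.card ≤ 2 :=
    fun M hM => card_le_two_of_isInducedMatching hμ₁ hμ₂ hm₁ hm₂ hQ hM
  have hexp0 : 3 * (insert e P).card ≤ 2 * (bdry I (insert e P)).card := hB _ ((card_le_card subset_union_left).trans hr)
  rcases two_edges_or_cherry hI hS h2 hIM he hcyc hexp0 with ⟨j₁, j₂, hne, hP, hdisj⟩ |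
      ⟨j₀, j₂, j₃, cc, h02, h03, h23, hP, hc0, hc2, hc3, hadeg, hother⟩
  · have hj₁ : j₁ ∈ P := by rw [hP]; exact mem_insert_self _ _
    have hj₂ : j₂ ∈ P := by rw [hP]; exact mem_insert_of_mem (mem_singleton_self _)
    have hne₁ := and_ne I hI j₁
    have hne₂ := and_ne I hI j₂
    have e1 := hadj (I.vars j₁ 2) (I.vars j₁ 3)
    rw [if_pos ⟨j₁, hj₁, Or.inl ⟨rfl, rfl⟩⟩] at e1
    have e2 := hadj (I.vars j₂ 2) (I.vars j₂ 3)
    rw [if_pos ⟨j₂, hj₂, Or.inl ⟨rfl, rfl⟩⟩] at e2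
    have main : ∀ {σ σ' τ τ' : Fin n}, andPair I j₁ = {σ, σ'} → andPair I j₂ = {τ, τ'} → σ ≠ σ' → τ ≠ τ' →
        (linPart hμ₁ (Pi.single σ 1) ≠ 0 ∨ linPart hμ₂ (Pi.single σ 1) ≠ 0) →
        (linPart hμ₁ (Pi.single τ 1) ≠ 0 ∨ linPart hμ₂ (Pi.single τ 1) ≠ 0) →
        ∃ j₁ j₂ : Fin m, ∃ σ τ : Fin n, j₁ ≠ j₂ ∧ P = {j₁, j₂} ∧ Disjoint (andPair I j₁) (andPair I j₂) ∧ σ ∈ andPair I j₁ ∧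
          τ ∈ andPair I j₂ ∧ (∀ v : Fin n, (linPart hμ₁ (Pi.single v 1) ≠ 0 ∨ linPart hμ₂ (Pi.single v 1) ≠ 0) ↔ (v = σ ∨ v = τ)) ∧
          ∃ g ∈ G, σ ∈ andPair I g ∧ τ ∈ andPair I g := by
      intro σ σ' τ τ' hσe hτe hσσ' hττ' hlσ hlτ
      by_cases hlτ' : linPart hμ₁ (Pi.single τ' 1) ≠ 0 ∨ linPart hμ₂ (Pi.single τ' 1) ≠ 0
      · by_cases hlσ' : linPart hμ₁ (Pi.single σ' 1) ≠ 0 ∨ linPart hμ₂ (Pi.single σ' 1) ≠ 0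
        · exact (false_of_four_lit_na hI hS hB he hGd hr hcyc hμ₁ hμ₂ hm₁ hm₂ hQ hK hP hne hdisj hσe hτe hσσ' hττ'
            hlσ hlσ' hlτ hlτ').elim
        · have hP' : P = {j₂, j₁} := by rw [hP, pair_comm]
          obtain ⟨a, b, x, y, h⟩ :=
            of_lits_na hI hS hB he hGd hr hcyc hμ₁ hμ₂ hm₁ hm₂ hQ hK hP' hne.symm hdisj.symm hτe hσe hττ' hσσ' hrank hlτ hlσ hlσ'
          exact ⟨a, b, x, y, h⟩
      · exact of_lits_na hI hS hB he hGd hr hcyc hμ₁ hμ₂ hm₁ hm₂ hQ hK hP hne hdisj hσe hτe hσσ' hττ' hrank hlσ hlτ hlτ'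
    have hA₁ : andPair I j₁ = {I.vars j₁ 2, I.vars j₁ 3} := rfl
    have hA₁' : andPair I j₁ = {I.vars j₁ 3, I.vars j₁ 2} := pair_comm _ _
    have hA₂ : andPair I j₂ = {I.vars j₂ 2, I.vars j₂ 3} := rfl
    have hA₂' : andPair I j₂ = {I.vars j₂ 3, I.vars j₂ 2} := pair_comm _ _
    rcases lit_of_adj e1 with hl | hl <;> rcases lit_of_adj e2 with hl' | hl'
    · exact main hA₁ hA₂ hne₁ hne₂ hl hl'
    · exact main hA₁ hA₂' hne₁ hne₂.symm hl hl'
    · exact main hA₁' hA₂ hne₁.symm hne₂ hl hl'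
    · exact main hA₁' hA₂' hne₁.symm hne₂.symm hl hl'
  · exact (false_of_cherry_na hI hS hB he hGd hr hcyc hμ₁ hμ₂ hm₁ hm₂ hQ hK hrank h02 h03 h23 hP hc0 hc2 hc3 hadeg hother).elim

end Main

end Summit.PneNP.PneNP.Theorems.PstarNorUnitNA
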